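import Summits.BirchSwinnertonDyer.Rank1Residual.X11a.SelmerCompanionStrictPlaces
import Summits.BirchSwinnertonDyer.Rank1Residual.X11a.SelmerCompanionResidueCertificateReading
import HarnessLib

/-!
# Route (3e) SELMER COMPANION, XXVI: kinds (iv) and (vi) at the prime `ℓ = 2`
# (class X11a = N7; cell `b2b-bsdres`, unit `b2b-bsdres-x11a`, gen 30)

HONEST FRAMING (run/shared/lean/b2b/bsd-rank1-residual/, verbatim in every file): the goal of the
cell is to DELETE the COMBINATION-SHAPED residual classes of the Birch–Swinnerton-Dyer formula for
ALL analytic-rank `≤ 1` elliptic curves over `ℚ` — "full BSD formula for every rank `≤ 1` curve in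
class `C`" assembled STRICTLY from published theorems — so that the rank-`≤ 1` remainder becomes
exactly the CONSTRUCTION-SHAPED classes, which are TYPED (missing-input `Prop`s), NOT attempted.
This is not "finishing BSD". CLASS-OWNERS.md: research routes; NO CLAIM BEYOND STATED CLASSES.
THEOREMS ONLY; nothing booked; no label moves. CONDITIONAL on the PUBLISHED binder A41
(`hU : Silverman1994_thmV53_corV54_tateUniformisation`, Tate uniformisation with the twist).

## What this file proves

Kinds (iv) (`E` NON-SPLIT multiplicative, `A` good) and (vi) (`E` good, `A` NON-SPLIT
multiplicative) of the count of route (3e) were available over `ℚ` only at ODD primes `ℓ ≠ p`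
(files IV, XI-b: the inertia group fixes `√γ`, `γ = −c₄/c₆`, because `c₄, c₆` are `ℓ`-units and
`ℓ` is odd — `X2.GreenbergVatsalTateDatumRat.inertia_fix_sqrt_gamma`). Census v6 lists `ℓ = 2` as
a lossy place in 14 of the 33 remaining eligible N7 cells at `p = 3`. This file removes the
restriction:

* `four_dvd_c₄_add_c₆_of_not_two_dvd_c₄` — for an integral Weierstrass equation with `c₄` odd
  (multiplicative reduction at `2`), `a₁` is odd, so `b₂ ≡ 1 (mod 4)` and `4 ∣ c₄ + c₆`;
* `inertia_fix_sqrt_gamma_two` — **at `ℓ = 2` the inertia group fixes `√γ(E)`** for a globally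
  minimal `E/ℚ` multiplicative at `2`: `γ = −c₄/c₆` is a `2`-adic unit with `4 ∣ c₄ + c₆`, so
  `u = (√γ − 1)/2` is integral (`u² + u = (γ − 1)/4`); an inertia element moving `√γ` to `−√γ`
  would move `u` by the unit `−√γ` (Neukirch II (9.3): inertia moves integers within `𝔪`) —
  i.e. `ℚ₂(√γ)/ℚ₂` is unramified, as it must be for a curve with multiplicative reduction;
* `h1Equiv_mem_selmerLocalKer_of_nonsplit_of_good_rat_two` (kind (iv) at `2`) and
  `h1Equiv_mem_selmerLocalKer_of_good_of_nonsplit_rat_two` (kind (vi) at `2`): the general lemmas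
  of files IV / XI-b fed with `inertia_fix_sqrt_gamma_two`.

The booking shapes with an ABSTRACT agreement hypothesis (so that these and any further kinds are
consumed without a new dispatcher) are in file XXVII. Not a class theorem; nothing booked.

References: [SilvermanAEC2009] VII.5 Prop. 5.1(b), III.1 (`b₂, c₄, c₆`); [SilvermanATAEC1994]
Ch. V Lemma 5.2, Thm. 5.3, Cor. 5.4, Ex. 5.11; [NeukirchANT1999] II (9.3); [GrossLMS1991] §7 (7.1);
files IV, XI-b; HOME/b2b-bsdres-x11a/REPORT-g30.md.
-/

set_option autoImplicit false

noncomputable section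

open scoped Classical NNReal

open WeierstrassCurve Literature.NumberTheory.EllipticCurves
  Literature.NumberTheory.GaloisRepresentations Field NumberField IsDedekindDomain
  IsDedekindDomain.HeightOneSpectrum Literature.NumberTheory.EllipticCurves.Rank1Residual
  Literature.NumberTheory.EllipticCurves.Rank1Residual.Typed

namespace Summit.BirchSwinnertonDyer.Rank1Residual.X11a.SelmerCompanion

/-! ## §1 At `ℓ = 2` the inertia group fixes `√γ` -/

/-- **`4 ∣ c₄ + c₆` when `c₄` is odd** (integral Weierstrass equation): `c₄ = b₂² − 24b₄` odd forces
`b₂ = a₁² + 4a₂` odd, so `a₁` odd and `b₂ ≡ 1 (mod 4)`; then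
`c₄ + c₆ = b₂²(1 − b₂) + 12b₄(3b₂ − 2) − 216b₆ ≡ 0 (mod 4)`. Silverman, *AEC* III.1 (the formulae
for `b₂, c₄, c₆`). [folklore] -/
theorem four_dvd_c₄_add_c₆_of_not_two_dvd_c₄ (V : WeierstrassCurve ℤ) (h : ¬ (2 : ℤ) ∣ V.c₄) :
    (4 : ℤ) ∣ V.c₄ + V.c₆ := by
  rcases Int.even_or_odd V.a₁ with ⟨m, hm⟩ | ⟨m, hm⟩
  · exfalso
    apply h
    refine ⟨8 * (m ^ 2 + V.a₂) ^ 2 - 12 * V.b₄, ?_⟩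
    rw [WeierstrassCurve.c₄, WeierstrassCurve.b₂, hm]
    ring
  · have hb₂ : V.b₂ = 1 + 4 * (m ^ 2 + m + V.a₂) := by
      rw [WeierstrassCurve.b₂, hm]; ring
    refine ⟨-(m ^ 2 + m + V.a₂) * V.b₂ ^ 2 + 3 * V.b₄ * (3 * V.b₂ - 2) - 54 * V.b₆, ?_⟩
    rw [WeierstrassCurve.c₄, WeierstrassCurve.c₆, hb₂]
    ring

/-- **At `ℓ = 2` the inertia group fixes `t = √γ(E)`, `γ = −c₄/c₆`, for a globally minimal `E/ℚ`
with MULTIPLICATIVE reduction at `2`** (the `ℓ = 2` companion of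
`X2.GreenbergVatsalTateDatumRat.inertia_fix_sqrt_gamma`; hypothesis `ht` of the general kinds
(iv), (vi) of files IV / XI-b). `c₄`, `c₆` are odd (Silverman VII.5.1(b), tree
`dvd_and_not_dvd_c₄_of_hasMultiplicativeReductionAtPrime`, `not_dvd_c₆_of_…`) and `4 ∣ c₄ + c₆`
(`four_dvd_c₄_add_c₆_of_not_two_dvd_c₄`), so `γ` is a unit with `(γ − 1)/4 ∈ ℤ₂`; `u = (t − 1)/2`
satisfies `u² + u = (γ − 1)/4`, hence `|u|_v ≤ 1`; for `σ` in the inertia group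
`|σu − u|_v < 1` (Neukirch II (9.3), tree `mem_inertia_iff_spectralValuation`), while `σt = ±t`
and `σt = −t` would give `σu − u = −t`, a unit. So `ℚ₂(√γ)` is unramified: the split / non-split
dichotomy `γ ∈ ℚ₂^{×2}` or not (Silverman *ATAEC* V.5.3) is the unramified one at `2` as well.
[cite: SilvermanAEC2009, VII.5 Prop. 5.1(b)] [cite: SilvermanATAEC1994, Ch. V Lemma 5.2 (c), Thm. 5.3 (a),(b), Cor. 5.4]
[cite: NeukirchANT1999, Ch. II §9 Prop. (9.3)] -/
theorem inertia_fix_sqrt_gamma_two (W : WeierstrassCurve ℚ) [W.IsElliptic] [W.IsGloballyMinimal]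
    (hmult : W.HasMultiplicativeReductionAtPrime 2) {v : HeightOneSpectrum (𝓞 ℚ)}
    (h2v : ((2 : ℕ) : 𝓞 ℚ) ∈ v.asIdeal) {𝔐 : Ideal v.localAbsIntegers} (h𝔐 : 𝔐 ∈ v.localPrimesAbove) :
    ∀ t : AlgebraicClosure (v.adicCompletion ℚ),
      t ^ 2 = algebraMap (v.adicCompletion ℚ) (AlgebraicClosure (v.adicCompletion ℚ))
        (algebraMap ℚ (v.adicCompletion ℚ) (-(W.c₄ / W.c₆))) →
      ∀ σ ∈ 𝔐.inertia (absoluteGaloisGroup (v.adicCompletion ℚ)),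
        Field.absoluteGaloisGroup.toAlgEquiv (v.adicCompletion ℚ) σ t = t := by
  intro t ht σ hσ
  haveI : CharZero (AlgebraicClosure (v.adicCompletion ℚ)) :=
    charZero_of_injective_algebraMap (algebraMap ℚ (AlgebraicClosure (v.adicCompletion ℚ))).injective
  obtain ⟨w, hw⟩ := v.exists_spectralValuation
  obtain ⟨-, hc₄⟩ := Additive.dvd_and_not_dvd_c₄_of_hasMultiplicativeReductionAtPrime W 2 hmult
  have hc₆ := X2.GreenbergVatsalTateDatumRat.not_dvd_c₆_of_hasMultiplicativeReductionAtPrime W hmult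
  rw [Nat.cast_ofNat] at hc₄ hc₆
  obtain ⟨k, hk⟩ := four_dvd_c₄_add_c₆_of_not_two_dvd_c₄ (integralModelInt W) hc₄
  -- `γ` in `K̄_v`
  have h4 : W.c₄ = ((integralModelInt W).c₄ : ℚ) := by
    conv_lhs => rw [← WeierstrassCurve.map_integralModelInt W]
    rw [WeierstrassCurve.map_c₄, eq_intCast]
  have h6 : W.c₆ = ((integralModelInt W).c₆ : ℚ) := by
    conv_lhs => rw [← WeierstrassCurve.map_integralModelInt W]
    rw [WeierstrassCurve.map_c₆, eq_intCast]
  have hγ : algebraMap (v.adicCompletion ℚ) (AlgebraicClosure (v.adicCompletion ℚ))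
      (algebraMap ℚ (v.adicCompletion ℚ) (-(W.c₄ / W.c₆))) =
      -((((integralModelInt W).c₄ : ℤ) : AlgebraicClosure (v.adicCompletion ℚ)) /
        (((integralModelInt W).c₆ : ℤ) : AlgebraicClosure (v.adicCompletion ℚ))) := by
    rw [← IsScalarTower.algebraMap_apply ℚ (v.adicCompletion ℚ)
      (AlgebraicClosure (v.adicCompletion ℚ)), h4, h6, map_neg, map_div₀, map_intCast, map_intCast]
  have hw4 : w (((integralModelInt W).c₄ : ℤ) : AlgebraicClosure (v.adicCompletion ℚ)) = 1 :=
    spectralValuation_intCast_eq_one_of_natCast_mem h2v hw (by rwa [Nat.cast_ofNat])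
  have hw6 : w (((integralModelInt W).c₆ : ℤ) : AlgebraicClosure (v.adicCompletion ℚ)) = 1 :=
    spectralValuation_intCast_eq_one_of_natCast_mem h2v hw (by rwa [Nat.cast_ofNat])
  have hc₆0 : (((integralModelInt W).c₆ : ℤ) : AlgebraicClosure (v.adicCompletion ℚ)) ≠ 0 := by
    intro h0; rw [h0, map_zero] at hw6; exact zero_ne_one hw6
  have hwt2 : w t ^ 2 = 1 := by
    rw [← map_pow, ht, hγ, Valuation.map_neg, map_div₀, hw4, hw6, div_one]
  have hwt : w t = 1 := by
    rcases lt_trichotomy (w t) 1 with h | h | h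
    · exact absurd hwt2 (ne_of_lt (pow_lt_one₀ zero_le h two_ne_zero))
    · exact h
    · exact absurd hwt2 (ne_of_gt (one_lt_pow₀ h two_ne_zero))
  -- `u = (t - 1)/2` is integral: `u² + u = (γ - 1)/4 = -k/c₆`
  set u : AlgebraicClosure (v.adicCompletion ℚ) := (t - 1) / 2 with hu
  have h20 : (2 : AlgebraicClosure (v.adicCompletion ℚ)) ≠ 0 := two_ne_zero
  have huu : u ^ 2 + u = -((k : ℤ) : AlgebraicClosure (v.adicCompletion ℚ)) /
      (((integralModelInt W).c₆ : ℤ) : AlgebraicClosure (v.adicCompletion ℚ)) := by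
    have h1 : u ^ 2 + u = (t ^ 2 - 1) / 4 := by rw [hu]; field_simp; ring
    have hk' : (((integralModelInt W).c₄ : ℤ) : AlgebraicClosure (v.adicCompletion ℚ)) +
        (((integralModelInt W).c₆ : ℤ) : AlgebraicClosure (v.adicCompletion ℚ)) =
        4 * ((k : ℤ) : AlgebraicClosure (v.adicCompletion ℚ)) := by
      rw [← Int.cast_add, hk, Int.cast_mul, Int.cast_ofNat]
    rw [h1, ht, hγ]
    field_simp
    linear_combination (-1 : AlgebraicClosure (v.adicCompletion ℚ)) * hk'
  have hwu : w u ≤ 1 := by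
    by_contra hlt
    rw [not_le] at hlt
    have hval : w (u ^ 2 + u) ≤ 1 := by
      rw [huu, map_div₀, Valuation.map_neg, hw6, div_one]
      exact spectralValuation_intCast_le_one hw k
    have hu1 : w (u + 1) = w u := by
      rw [Valuation.map_add_eq_of_lt_left]
      rwa [Valuation.map_one]
    have : w (u ^ 2 + u) = w u ^ 2 := by
      rw [show u ^ 2 + u = u * (u + 1) by ring, Valuation.map_mul, hu1, pow_two]
    rw [this] at hval
    exact absurd hval (not_le.mpr (one_lt_pow₀ hlt two_ne_zero))
  -- inertia moves `u` by less than `1`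
  have hlt : w (σ • u - u) < 1 := (mem_inertia_iff_spectralValuation hw h𝔐).1 hσ u hwu
  -- `(σ t)² = t²`
  have hsq : (σ • t) ^ 2 = t ^ 2 := by
    rw [Field.absoluteGaloisGroup.smul_def, ← map_pow, ht, AlgEquiv.commutes]
  have hcases : σ • t = t ∨ σ • t = -t := by
    have h0 : (σ • t - t) * (σ • t + t) = 0 := by
      have : (σ • t - t) * (σ • t + t) = (σ • t) ^ 2 - t ^ 2 := by ring
      rw [this, hsq, sub_self]
    rcases mul_eq_zero.mp h0 with h | h
    · exact Or.inl (sub_eq_zero.mp h)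
    · exact Or.inr (eq_neg_of_add_eq_zero_left h)
  have hσu : σ • u = (σ • t - 1) / 2 := by
    rw [hu, Field.absoluteGaloisGroup.smul_def, Field.absoluteGaloisGroup.smul_def, map_div₀,
      map_sub, map_one, map_ofNat]
  rcases hcases with h | h
  · rw [← Field.absoluteGaloisGroup.smul_def]; exact h
  · exfalso
    have hrew : σ • u - u = -t := by
      rw [hσu, h, hu]; field_simp; ring
    rw [hrew, Valuation.map_neg, hwt] at hlt
    exact lt_irrefl _ hlt

/-! ## §2 Kinds (iv) and (vi) over `ℚ` at `ℓ = 2` -/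

section Rat

variable (W A : WeierstrassCurve ℚ) [W.IsElliptic] [A.IsElliptic] (p : ℕ) [hp : Fact p.Prime]

/-- **Kind (iv) over `ℚ` at `ℓ = 2`**: for `θ : E[p] ≃ A[p]`, `p` odd, the globally minimal `E`
NON-SPLIT multiplicative at `2` (`γ(E)` not a square in `ℚ₂`) and `A` good at `2`:
`θ_* 𝓢_2(E) ≤ 𝓢_2(A)` — file IV's general lemma with the inertia hypothesis supplied by
`inertia_fix_sqrt_gamma_two`. [cite: SilvermanATAEC1994, Ch. V Thm. 5.3, Cor. 5.4, Ex. 5.11]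
[cite: GrossLMS1991, §7 (7.1)] -/
theorem h1Equiv_mem_selmerLocalKer_of_nonsplit_of_good_rat_two [W.IsGloballyMinimal]
    (hU : Silverman1994_thmV53_corV54_tateUniformisation.{0}) (hp2 : p ≠ 2)
    (θ : geomTorsion W (p : ℤ) ≃+ geomTorsion A (p : ℤ))
    (hθ : ∀ (σ : absoluteGaloisGroup ℚ) (P : geomTorsion W (p : ℤ)), θ (σ • P) = σ • θ P)
    {v : HeightOneSpectrum (𝓞 ℚ)} (h2v : ((2 : ℕ) : 𝓞 ℚ) ∈ v.asIdeal)
    (hmult : W.HasMultiplicativeReductionAtPrime 2)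
    (hγ : ∀ r : v.adicCompletion ℚ, algebraMap ℚ (v.adicCompletion ℚ) (-(W.c₄ / W.c₆)) ≠ r ^ 2)
    (hA : A.HasGoodReductionAt v) (hpv : (p : 𝓞 ℚ) ∉ v.asIdeal)
    {c : galH1Torsion W (p : ℤ)} (hc : c ∈ selmerLocalKer W (v.adicCompletion ℚ) (p : ℤ)) :
    h1Equiv θ hθ c ∈ selmerLocalKer A (v.adicCompletion ℚ) (p : ℤ) := by
  have hW : W.HasMultiplicativeReductionAt v := by
    have hvp : (Rat.HeightOneSpectrum.primesEquiv v : ℕ) = 2 :=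
      Rat.HeightOneSpectrum.primesEquiv_eq_of_natCast_mem v Nat.prime_two h2v
    have key : ∀ (q : ℕ) (hq : Fact q.Prime), q = 2 →
        (@WeierstrassCurve.HasMultiplicativeReductionAtPrime W q hq ↔
          W.HasMultiplicativeReductionAt v) → W.HasMultiplicativeReductionAt v := by
      rintro q hq rfl h; exact h.mp hmult
    exact key _ _ hvp
      (W.hasMultiplicativeReductionAtPrime_iff_hasMultiplicativeReductionAt_ringOfIntegers v)
  exact h1Equiv_mem_selmerLocalKer_of_nonsplit_of_good W v hU hp2 A θ hθ hW hγ hA hpv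
    (fun {𝔐} h𝔐 t ht2 σ hσ ↦ inertia_fix_sqrt_gamma_two W hmult h2v h𝔐 t ht2 σ hσ) hc

/-- **Kind (vi) over `ℚ` at `ℓ = 2`**: for `θ : E[p] ≃ A[p]`, `p` odd, `E` good at `2` and the
globally minimal partner `A` NON-SPLIT multiplicative at `2` (`γ(A)` not a square in `ℚ₂`):
`θ_* 𝓢_2(E) ≤ 𝓢_2(A)` — file XI-b's general lemma with `inertia_fix_sqrt_gamma_two` for `A`.
[cite: SilvermanATAEC1994, Ch. V Thm. 5.3, Cor. 5.4, Ex. 5.11] [cite: GrossLMS1991, §7 (7.1)]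
[cite: MilneADT2006, Ch. I Prop. 3.8] -/
theorem h1Equiv_mem_selmerLocalKer_of_good_of_nonsplit_rat_two [A.IsGloballyMinimal]
    (hU : Silverman1994_thmV53_corV54_tateUniformisation.{0}) (hp2 : p ≠ 2)
    (θ : geomTorsion W (p : ℤ) ≃+ geomTorsion A (p : ℤ))
    (hθ : ∀ (σ : absoluteGaloisGroup ℚ) (P : geomTorsion W (p : ℤ)), θ (σ • P) = σ • θ P)
    {v : HeightOneSpectrum (𝓞 ℚ)} (h2v : ((2 : ℕ) : 𝓞 ℚ) ∈ v.asIdeal)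
    (hW : W.HasGoodReductionAt v) (hmult : A.HasMultiplicativeReductionAtPrime 2)
    (hγ : ∀ r : v.adicCompletion ℚ, algebraMap ℚ (v.adicCompletion ℚ) (-(A.c₄ / A.c₆)) ≠ r ^ 2)
    (hpv : (p : 𝓞 ℚ) ∉ v.asIdeal)
    {c : galH1Torsion W (p : ℤ)} (hc : c ∈ selmerLocalKer W (v.adicCompletion ℚ) (p : ℤ)) :
    h1Equiv θ hθ c ∈ selmerLocalKer A (v.adicCompletion ℚ) (p : ℤ) := by
  have hA : A.HasMultiplicativeReductionAt v := by
    have hvp : (Rat.HeightOneSpectrum.primesEquiv v : ℕ) = 2 :=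
      Rat.HeightOneSpectrum.primesEquiv_eq_of_natCast_mem v Nat.prime_two h2v
    have key : ∀ (q : ℕ) (hq : Fact q.Prime), q = 2 →
        (@WeierstrassCurve.HasMultiplicativeReductionAtPrime A q hq ↔
          A.HasMultiplicativeReductionAt v) → A.HasMultiplicativeReductionAt v := by
      rintro q hq rfl h; exact h.mp hmult
    exact key _ _ hvp
      (A.hasMultiplicativeReductionAtPrime_iff_hasMultiplicativeReductionAt_ringOfIntegers v)
  exact h1Equiv_mem_selmerLocalKer_of_good_of_nonsplit W v hU hp2 A θ hθ hW hA hγ hpv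
    (fun {𝔐} h𝔐 t ht2 σ hσ ↦ inertia_fix_sqrt_gamma_two A hmult h2v h𝔐 t ht2 σ hσ) hc

end Rat

end Summit.BirchSwinnertonDyer.Rank1Residual.X11a.SelmerCompanion

end
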